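import Literature.AlgebraicGeometry.Motives.HodgeStructureLefschetzGroupPoints
import Literature.AlgebraicGeometry.Motives.MumfordTateGroupFieldExtension
import HarnessLib

/-!
# Milne 1999, Remark 1.6 ON POINTS: along a field extension `K → L ⊇ ℚ`, `γ ↦ γ_L` identifies `S(H)(K)` with
# `S(H)(L) ∩ GL(K ⊗ V)` and `G(H)(K)` with `G(H)(L) ∩ GL(K ⊗ V)`, multipliers matching under `K → L`

[topic AlgebraicGeometry/Motives]

Layer `Literature/AlgebraicGeometry/Motives`, lane `lit-hodgefound` (Track 2 foundations library; seat `lit-hodgefound-p34`,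
generation 19, self-proposed row g19-#4 of `run/shared/lean/pub/lit-hodgefound/SKELETON.md`). THEOREMS ONLY (no definition, no
named fact; net debt `0`). CARRIER: a pure `ℚ`-Hodge structure `H` on `V` with a polarization `Q`, Milne's groups in the tree's
point-wise form `S(H)(K) = Polarization.lefschetzGroupBaseChange K Q`, `G(H)(K) = Polarization.lefschetzSimilitudeGroupBaseChange K Q`
(g18-#1 `Motives/HodgeStructureLefschetzGroupPoints`: the `γ ∈ GL(K ⊗_ℚ V)` commuting with every `a_K`, `a ∈ E_φ`, and preserving
`Q_K` / multiplying it by some `ν ≠ 0`), and the extension of scalars `j : K ⊗_ℚ V → L ⊗_ℚ V`, `γ ↦ γ_L : GL(K ⊗ V) →* GL(L ⊗ V)`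
of `Motives/MumfordTateGroupFieldExtension` (`extendScalars`, `glExtendScalars`, `glExtendScalarsHom`; there the same statements
for `MT(H)` and `Hg(H)`), for fields `ℚ ⊆ K ⊆ L`.

Milne's `S(A)` and `G(A)` are ALGEBRAIC GROUPS over the coefficient field `k`; Remark 1.6 says that passing to a larger coefficient
field `k'` replaces them by their base changes `S(A)_{/k'}`, `C(A) ⊗_k k'`. Read through the functor of points this is the
compatibility proved here: the `K`-points are the `L`-points that are defined over `K`, i.e. `S(H)(K)` is the preimage of `S(H)(L)`
under `γ ↦ γ_L`, and likewise for `G(H)` with the multiplier transported by `K → L`.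

## The source, verbatim

J. S. Milne, *Lefschetz classes on abelian varieties*, Duke Math. J. **96** (1999) 639–675 [Milne1999LefschetzClasses] (held
`paper:doi-10-1215-s0012-7094-99-09620-5` p0006 L30–L45, p. 644): "**Remark 1.6.** If `X ↦ H*(X)` is a Weil cohomology theory
with coefficient field `k`, and `k'` is a field containing `k`, then `X ↦ H*(X) ⊗_k k'` is a Weil cohomology theory with
coefficient field `k'`. If `C'(A)` and `S'(A)` denote the objects defined relative to the second theory, then there are canonical
isomorphisms `C'(A) ≅ C(A) ⊗_k k'`, `S'(A) ≅ S(A)_{/k'}`. […] The comparison theorems between the various cohomology theories,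
together with (1.6), show that, when `A` is an abelian variety over `ℂ`, there are canonical isomorphisms `S_B(A)_{/ℚ_ℓ} ≅ S_ℓ(A)`,
…"; §1 p. 644 L16–L20 ("`S(A)(R) = {γ ∈ C(A) ⊗_k R | γ†γ = 1}` for all commutative `k`-algebras `R`") and §4 p. 659 L10–L14
("`G(A)(R) = {γ ∈ C(A) ⊗ R | γ†γ ∈ R^×}`"). P. Deligne, *Hodge cycles on abelian varieties*, LNM 900 (1982) [Deligne1982HodgeCycles],
I §3.1 (algebraic groups over `ℚ` through their points; the tree's `MumfordTateGroupFieldExtension` does `MT`, `Hg`).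

## What is PROVED (fields `ℚ ⊆ K ⊆ L`, `j = extendScalars K L V`, `γ_L = glExtendScalars K L V γ`)

* §1 plumbing for `j`: **`extendScalars_baseChange_apply`** (`j (a_K x) = a_L (j x)` for `a ∈ End_ℚ V`),
  **`baseChange_extendScalars_extendScalars`** (`B_L(j x, j y) = (K → L)(B_K(x, y))` for a `ℚ`-bilinear form `B`),
  **`extendScalars_injective`** (`K → L` is injective and `V` is flat over `ℚ`).
* §2 transport of the two defining conditions: `γ` commutes with `a_K` iff `γ_L` commutes with `a_L`
  (`glExtendScalars_baseChange_comm_iff`); `B_K(γ x, γ y) = ν B_K(x, y)` for all `x, y` iff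
  `B_L(γ_L x', γ_L y') = (K → L)(ν) B_L(x', y')` for all `x', y'` (`forall_baseChange_glExtendScalars_eq_mul_iff`; `L ⊗ V` is spanned
  over `L` by `j(K ⊗ V)`).
* §3 **`Polarization.glExtendScalars_mem_lefschetzGroupBaseChange_iff : γ_L ∈ S(H)(L) ↔ γ ∈ S(H)(K)`**,
  **`Polarization.comap_glExtendScalarsHom_lefschetzGroupBaseChange : S(H)(L).comap (γ ↦ γ_L) = S(H)(K)`** ("`S'(A) ≅ S(A)_{/k'}`" on
  points), `map_… ≤`; the same three for **`G(H)`** (`…lefschetzSimilitudeGroupBaseChange…`; for "⟸" the multiplier `ν' ∈ L` of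
  `γ_L` is shown to come from `K`: `ν' = (K → L)(Q_K(γ x₀, γ y₀) / Q_K(x₀, y₀))` at any pair with `Q_K(x₀, y₀) ≠ 0`, and `V = 0`
  otherwise), and the multiplier statement `Polarization.forall_form_glExtendScalars_eq_mul_iff`.

NOT here: the algebraic groups themselves and `C'(A) ≅ C(A) ⊗_k k'` for the ALGEBRA `C(A)` (the tree's
`forall_centralizer_endAlg_baseChange_comm_iff_mem_span_baseChange_endAlg` family treats `C(H) ⊗ K`); the comparison
isomorphisms `S_B(A)_{/ℚ_ℓ} ≅ S_ℓ(A)` (other cohomology theories).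

## References

* [Milne1999LefschetzClasses] J. S. Milne, *Lefschetz classes on abelian varieties*, Duke Math. J. 96 (1999) 639–675, §1
  Remark 1.6 (p. 644), p. 644 L16–L20, §4 p. 659.
* [Deligne1982HodgeCycles] P. Deligne, *Hodge cycles on abelian varieties*, in LNM 900, Springer (1982), I §3.1.
* [BourbakiAlgebraI1989] N. Bourbaki, *Algebra I*, Ch. II §5 no. 3 Prop. 7 and §7 no. 7 (extension of scalars along a field
  extension is faithful; `L ⊗_K (K ⊗_ℚ V) = L ⊗_ℚ V`).
-/

noncomputable section

open scoped TensorProduct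

namespace Literature.AlgebraicGeometry.Motives

universe u u' v

/-! ## §1 The extension of scalars `j : K ⊗_ℚ V → L ⊗_ℚ V` against base-changed endomorphisms and bilinear forms -/

section Plumbing

variable (K : Type u) (L : Type u') [Field K] [Field L] [Algebra ℚ K] [Algebra ℚ L] [Algebra K L]
  [IsScalarTower ℚ K L] (V : Type v) [AddCommGroup V] [Module ℚ V]

/-- **`j` intertwines the base changes of a `ℚ`-endomorphism**: `j (a_K x) = a_L (j x)`.
[cite: Milne1999LefschetzClasses, §1 Remark 1.6 (p. 644) ("C'(A) ≅ C(A) ⊗_k k'")] [cite: Deligne1982HodgeCycles, I §3.1] -/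
theorem extendScalars_baseChange_apply (a : Module.End ℚ V) (x : K ⊗[ℚ] V) :
    extendScalars K L V (a.baseChange K x) = a.baseChange L (extendScalars K L V x) := by
  induction x using TensorProduct.induction_on with
  | zero => simp only [map_zero]
  | tmul c v => rw [LinearMap.baseChange_tmul, extendScalars_tmul, extendScalars_tmul, LinearMap.baseChange_tmul]
  | add x y hx hy => rw [map_add, map_add, hx, hy, map_add, map_add]

/-- **A `ℚ`-bilinear form after the two base changes**: `B_L(j x, j y) = (K → L)(B_K(x, y))`.
[cite: Milne1999LefschetzClasses, §1 Remark 1.6 (p. 644)] [cite: BourbakiAlgebraI1989, Ch. II §7 no. 7] -/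
theorem baseChange_extendScalars_extendScalars (B : LinearMap.BilinForm ℚ V) (x y : K ⊗[ℚ] V) :
    B.baseChange L (extendScalars K L V x) (extendScalars K L V y) = algebraMap K L (B.baseChange K x y) := by
  induction x using TensorProduct.induction_on with
  | zero => simp only [map_zero, LinearMap.zero_apply]
  | tmul c v =>
    induction y using TensorProduct.induction_on with
    | zero => simp only [map_zero]
    | tmul d w =>
      simp only [extendScalars_tmul, LinearMap.BilinForm.baseChange_tmul, Algebra.smul_def, map_mul,
        ← IsScalarTower.algebraMap_apply ℚ K L]
    | add y₁ y₂ h₁ h₂ => simp only [map_add, h₁, h₂]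
  | add x₁ x₂ h₁ h₂ => simp only [map_add, LinearMap.add_apply, h₁, h₂]

/-- **`j : K ⊗_ℚ V → L ⊗_ℚ V` is injective** (`K → L` is injective and every `ℚ`-vector space is flat).
[cite: BourbakiAlgebraI1989, Ch. II §5 no. 3 Prop. 7] -/
theorem extendScalars_injective : Function.Injective (extendScalars K L V) := by
  haveI : Module.Free ℚ V := Module.Free.of_divisionRing ℚ V
  have hf : Function.Injective (((Algebra.linearMap K L).restrictScalars ℚ).rTensor V) :=
    Module.Flat.rTensor_preserves_injective_linearMap _ (algebraMap K L).injective
  have heq : ∀ x, extendScalars K L V x = ((Algebra.linearMap K L).restrictScalars ℚ).rTensor V x := by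
    intro x
    induction x using TensorProduct.induction_on with
    | zero => simp only [map_zero]
    | tmul c v => rw [extendScalars_tmul, LinearMap.rTensor_tmul]; rfl
    | add x y hx hy => rw [map_add, map_add, hx, hy]
  intro x y hxy
  exact hf (by rw [← heq, ← heq, hxy])

/-- A pure tensor of `L ⊗_ℚ V` is an `L`-multiple of a vector of `j(K ⊗ V)`: `l ⊗ v = l • j(1 ⊗ v)`. Private plumbing. [folklore] -/
private theorem tmul_eq_smul_extendScalars (l : L) (v : V) :
    (l ⊗ₜ[ℚ] v : L ⊗[ℚ] V) = l • extendScalars K L V ((1 : K) ⊗ₜ[ℚ] v) := by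
  rw [extendScalars_one_tmul, TensorProduct.smul_tmul', smul_eq_mul, mul_one]

/-! ## §2 Transport of the two defining conditions along `γ ↦ γ_L` -/

/-- **`γ` commutes with `a_K` iff `γ_L` commutes with `a_L`** (`a ∈ End_ℚ V`): "⟸" on `j(K ⊗ V)` by the injectivity of `j`,
"⟹" because `L ⊗ V` is spanned over `L` by `j(K ⊗ V)`. [cite: Milne1999LefschetzClasses, §1 Remark 1.6 (p. 644)]
[cite: Deligne1982HodgeCycles, I §3.1] -/
theorem glExtendScalars_baseChange_comm_iff (γ : (K ⊗[ℚ] V) ≃ₗ[K] (K ⊗[ℚ] V)) (a : Module.End ℚ V) :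
    (∀ y, a.baseChange L (glExtendScalars K L V γ y) = glExtendScalars K L V γ (a.baseChange L y)) ↔
      ∀ x, a.baseChange K (γ x) = γ (a.baseChange K x) := by
  constructor
  · intro h x
    apply extendScalars_injective K L V
    rw [extendScalars_baseChange_apply, ← glExtendScalars_extendScalars, h, ← extendScalars_baseChange_apply,
      glExtendScalars_extendScalars]
  · intro h y
    induction y using TensorProduct.induction_on with
    | zero => simp only [map_zero]
    | tmul l v =>
      simp only [tmul_eq_smul_extendScalars K L V l v, map_smul, glExtendScalars_extendScalars,
        ← extendScalars_baseChange_apply, h]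
    | add y₁ y₂ h₁ h₂ => simp only [map_add, h₁, h₂]

/-- **`B_K(γ x, γ y) = ν B_K(x, y)` for all `x, y` iff `B_L(γ_L x', γ_L y') = (K → L)(ν) B_L(x', y')` for all `x', y'`**
(`B` a `ℚ`-bilinear form, `ν ∈ K`): "⟸" on `j(K ⊗ V)` by the injectivity of `K → L`, "⟹" by `L`-bilinearity from the values on
`j(K ⊗ V) × j(K ⊗ V)`. [cite: Milne1999LefschetzClasses, §1 Remark 1.6 (p. 644) and §4 p. 659 L10–L14] -/
theorem forall_baseChange_glExtendScalars_eq_mul_iff (γ : (K ⊗[ℚ] V) ≃ₗ[K] (K ⊗[ℚ] V)) (B : LinearMap.BilinForm ℚ V) (ν : K) :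
    (∀ x' y', B.baseChange L (glExtendScalars K L V γ x') (glExtendScalars K L V γ y') =
        algebraMap K L ν * B.baseChange L x' y') ↔
      ∀ x y, B.baseChange K (γ x) (γ y) = ν * B.baseChange K x y := by
  constructor
  · intro h x y
    apply (algebraMap K L).injective
    rw [← baseChange_extendScalars_extendScalars, ← glExtendScalars_extendScalars, ← glExtendScalars_extendScalars, h,
      baseChange_extendScalars_extendScalars, map_mul]
  · intro h
    -- on `j(K ⊗ V) × j(K ⊗ V)`
    have key : ∀ x y : K ⊗[ℚ] V,
        B.baseChange L (glExtendScalars K L V γ (extendScalars K L V x)) (glExtendScalars K L V γ (extendScalars K L V y)) =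
          algebraMap K L ν * B.baseChange L (extendScalars K L V x) (extendScalars K L V y) := fun x y ↦ by
      rw [glExtendScalars_extendScalars, glExtendScalars_extendScalars, baseChange_extendScalars_extendScalars,
        baseChange_extendScalars_extendScalars, h, map_mul]
    -- extend in the first variable
    have h₁ : ∀ (x' : L ⊗[ℚ] V) (y : K ⊗[ℚ] V),
        B.baseChange L (glExtendScalars K L V γ x') (glExtendScalars K L V γ (extendScalars K L V y)) =
          algebraMap K L ν * B.baseChange L x' (extendScalars K L V y) := by
      intro x' y
      induction x' using TensorProduct.induction_on with
      | zero => simp only [map_zero, LinearMap.zero_apply, mul_zero]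
      | tmul l v =>
        rw [tmul_eq_smul_extendScalars K L V l v, map_smul, map_smul, LinearMap.smul_apply, map_smul, LinearMap.smul_apply,
          key, smul_eq_mul, smul_eq_mul, mul_left_comm]
      | add a b ha hb => simp only [map_add, LinearMap.add_apply, ha, hb, mul_add]
    -- and in the second
    intro x' y'
    induction y' using TensorProduct.induction_on with
    | zero => simp only [map_zero, mul_zero]
    | tmul l w =>
      rw [tmul_eq_smul_extendScalars K L V l w, map_smul, map_smul, map_smul, h₁, smul_eq_mul, smul_eq_mul, mul_left_comm]
    | add a b ha hb => simp only [map_add, ha, hb, mul_add]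

/-- The case `ν = 1`: `γ` preserves `B_K` iff `γ_L` preserves `B_L`. [cite: Milne1999LefschetzClasses, §1 Remark 1.6 (p. 644) and p. 644 L16–L20] -/
theorem forall_baseChange_glExtendScalars_eq_iff (γ : (K ⊗[ℚ] V) ≃ₗ[K] (K ⊗[ℚ] V)) (B : LinearMap.BilinForm ℚ V) :
    (∀ x' y', B.baseChange L (glExtendScalars K L V γ x') (glExtendScalars K L V γ y') = B.baseChange L x' y') ↔
      ∀ x y, B.baseChange K (γ x) (γ y) = B.baseChange K x y := by
  have h := forall_baseChange_glExtendScalars_eq_mul_iff K L V γ B 1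
  simp only [map_one, one_mul] at h
  exact h

end Plumbing

namespace HodgeStructure

/-! ## §3 Remark 1.6 on points: `S(H)(K) = S(H)(L) ∩ GL(K ⊗ V)`, `G(H)(K) = G(H)(L) ∩ GL(K ⊗ V)` -/

section Points

variable (K : Type u) (L : Type u') [Field K] [Field L] [Algebra ℚ K] [Algebra ℚ L] [Algebra K L]
  [IsScalarTower ℚ K L] {V : Type v} [AddCommGroup V] [Module ℚ V] {n : ℤ} {H : HodgeStructure V n} (Q : Polarization H)

/-- **`γ_L ∈ S(H)(L) ↔ γ ∈ S(H)(K)`**: the `K`-points of `S` are the `L`-points defined over `K` ("`S'(A) ≅ S(A)_{/k'}`", on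
points). [cite: Milne1999LefschetzClasses, §1 Remark 1.6 (p. 644) and p. 644 L16–L20] -/
theorem Polarization.glExtendScalars_mem_lefschetzGroupBaseChange_iff (γ : (K ⊗[ℚ] V) ≃ₗ[K] (K ⊗[ℚ] V)) :
    glExtendScalars K L V γ ∈ Q.lefschetzGroupBaseChange L ↔ γ ∈ Q.lefschetzGroupBaseChange K := by
  rw [Polarization.mem_lefschetzGroupBaseChange_iff, Polarization.mem_lefschetzGroupBaseChange_iff,
    forall_baseChange_glExtendScalars_eq_iff]
  exact and_congr_left fun _ ↦ forall_congr' fun a ↦ glExtendScalars_baseChange_comm_iff K L V γ (a : Module.End ℚ V)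

/-- **`S(H)(K) = (γ ↦ γ_L)⁻¹ S(H)(L)` as subgroups of `GL(K ⊗ V)`** — Remark 1.6 "`S'(A) ≅ S(A)_{/k'}`" through the functor of
points. [cite: Milne1999LefschetzClasses, §1 Remark 1.6 (p. 644)] -/
theorem Polarization.comap_glExtendScalarsHom_lefschetzGroupBaseChange :
    (Q.lefschetzGroupBaseChange L).comap (glExtendScalarsHom K L V) = Q.lefschetzGroupBaseChange K := by
  ext γ
  rw [Subgroup.mem_comap, glExtendScalarsHom_apply]
  exact Q.glExtendScalars_mem_lefschetzGroupBaseChange_iff K L γ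

/-- The same as sets: `S(H)(K)` is the preimage of `S(H)(L)` under `γ ↦ γ_L`. [cite: Milne1999LefschetzClasses, §1 Remark 1.6 (p. 644)] -/
theorem Polarization.lefschetzGroupBaseChange_eq_preimage_glExtendScalars :
    (Q.lefschetzGroupBaseChange K : Set ((K ⊗[ℚ] V) ≃ₗ[K] (K ⊗[ℚ] V))) =
      glExtendScalars K L V ⁻¹' (Q.lefschetzGroupBaseChange L : Set ((L ⊗[ℚ] V) ≃ₗ[L] (L ⊗[ℚ] V))) := by
  ext γ
  exact (Q.glExtendScalars_mem_lefschetzGroupBaseChange_iff K L γ).symm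

/-- `S(H)(K)` maps into `S(H)(L)` under `γ ↦ γ_L`. [cite: Milne1999LefschetzClasses, §1 Remark 1.6 (p. 644)] -/
theorem Polarization.map_glExtendScalarsHom_lefschetzGroupBaseChange_le :
    (Q.lefschetzGroupBaseChange K).map (glExtendScalarsHom K L V) ≤ Q.lefschetzGroupBaseChange L := by
  rw [Subgroup.map_le_iff_le_comap, Q.comap_glExtendScalarsHom_lefschetzGroupBaseChange K L]

/-- **The multiplier is transported by `K → L`**: `γ` multiplies `Q_K` by `ν` iff `γ_L` multiplies `Q_L` by `(K → L)(ν)` ("`γ†γ ∈ R^×`"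
is compatible with `R → R'`). [cite: Milne1999LefschetzClasses, §4 p. 659 L10–L14 and §1 Remark 1.6 (p. 644)] -/
theorem Polarization.forall_form_glExtendScalars_eq_mul_iff (γ : (K ⊗[ℚ] V) ≃ₗ[K] (K ⊗[ℚ] V)) (ν : K) :
    (∀ x' y', Q.form.baseChange L (glExtendScalars K L V γ x') (glExtendScalars K L V γ y') =
        algebraMap K L ν * Q.form.baseChange L x' y') ↔
      ∀ x y, Q.form.baseChange K (γ x) (γ y) = ν * Q.form.baseChange K x y :=
  forall_baseChange_glExtendScalars_eq_mul_iff K L V γ Q.form ν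

/-- **`γ_L ∈ G(H)(L) ↔ γ ∈ G(H)(K)`**: the `K`-points of `G` are the `L`-points defined over `K`. "⟸": the multiplier `ν` of `γ`
becomes `(K → L)(ν)`; "⟹": the multiplier `ν'` of `γ_L` lies in the image of `K` — it is `(K → L)(Q_K(γ x₀, γ y₀) / Q_K(x₀, y₀))`
for any `x₀, y₀` with `Q_K(x₀, y₀) ≠ 0`, and if `Q_K = 0` every `ν` works. [cite: Milne1999LefschetzClasses, §4 p. 659 L10–L14 and §1 Remark 1.6 (p. 644)] -/
theorem Polarization.glExtendScalars_mem_lefschetzSimilitudeGroupBaseChange_iff (γ : (K ⊗[ℚ] V) ≃ₗ[K] (K ⊗[ℚ] V)) :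
    glExtendScalars K L V γ ∈ Q.lefschetzSimilitudeGroupBaseChange L ↔ γ ∈ Q.lefschetzSimilitudeGroupBaseChange K := by
  rw [Polarization.mem_lefschetzSimilitudeGroupBaseChange_iff, Polarization.mem_lefschetzSimilitudeGroupBaseChange_iff]
  constructor
  · rintro ⟨hc, ν', hν', hm'⟩
    refine ⟨fun a ↦ (glExtendScalars_baseChange_comm_iff K L V γ (a : Module.End ℚ V)).1 (hc a), ?_⟩
    by_cases hQ : ∃ x y, Q.form.baseChange K x y ≠ 0
    · obtain ⟨x₀, y₀, h₀⟩ := hQ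
      -- the multiplier of `γ_L` comes from `K`
      have hν : algebraMap K L (Q.form.baseChange K (γ x₀) (γ y₀) / Q.form.baseChange K x₀ y₀) = ν' := by
        have h1 := hm' (extendScalars K L V x₀) (extendScalars K L V y₀)
        rw [glExtendScalars_extendScalars, glExtendScalars_extendScalars, baseChange_extendScalars_extendScalars,
          baseChange_extendScalars_extendScalars] at h1
        rw [map_div₀, h1, mul_div_assoc, div_self ((map_ne_zero (algebraMap K L)).2 h₀), mul_one]
      refine ⟨Q.form.baseChange K (γ x₀) (γ y₀) / Q.form.baseChange K x₀ y₀, fun h ↦ hν' ?_,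
        (Q.forall_form_glExtendScalars_eq_mul_iff K L γ _).1 fun x' y' ↦ by rw [hν]; exact hm' x' y'⟩
      rw [← hν, h, map_zero]
    · simp only [not_exists, not_not] at hQ
      exact ⟨1, one_ne_zero, fun x y ↦ by rw [hQ, hQ, mul_zero]⟩
  · rintro ⟨hc, ν, hν, hm⟩
    exact ⟨fun a ↦ (glExtendScalars_baseChange_comm_iff K L V γ (a : Module.End ℚ V)).2 (hc a), algebraMap K L ν,
      (map_ne_zero (algebraMap K L)).2 hν, (Q.forall_form_glExtendScalars_eq_mul_iff K L γ ν).2 hm⟩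

/-- **`G(H)(K) = (γ ↦ γ_L)⁻¹ G(H)(L)` as subgroups of `GL(K ⊗ V)`.** [cite: Milne1999LefschetzClasses, §1 Remark 1.6 (p. 644) and §4 p. 659] -/
theorem Polarization.comap_glExtendScalarsHom_lefschetzSimilitudeGroupBaseChange :
    (Q.lefschetzSimilitudeGroupBaseChange L).comap (glExtendScalarsHom K L V) = Q.lefschetzSimilitudeGroupBaseChange K := by
  ext γ
  rw [Subgroup.mem_comap, glExtendScalarsHom_apply]
  exact Q.glExtendScalars_mem_lefschetzSimilitudeGroupBaseChange_iff K L γ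

/-- The same as sets: `G(H)(K)` is the preimage of `G(H)(L)` under `γ ↦ γ_L`. [cite: Milne1999LefschetzClasses, §1 Remark 1.6 (p. 644) and §4 p. 659] -/
theorem Polarization.lefschetzSimilitudeGroupBaseChange_eq_preimage_glExtendScalars :
    (Q.lefschetzSimilitudeGroupBaseChange K : Set ((K ⊗[ℚ] V) ≃ₗ[K] (K ⊗[ℚ] V))) =
      glExtendScalars K L V ⁻¹' (Q.lefschetzSimilitudeGroupBaseChange L : Set ((L ⊗[ℚ] V) ≃ₗ[L] (L ⊗[ℚ] V))) := by
  ext γ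
  exact (Q.glExtendScalars_mem_lefschetzSimilitudeGroupBaseChange_iff K L γ).symm

/-- `G(H)(K)` maps into `G(H)(L)` under `γ ↦ γ_L`. [cite: Milne1999LefschetzClasses, §1 Remark 1.6 (p. 644) and §4 p. 659] -/
theorem Polarization.map_glExtendScalarsHom_lefschetzSimilitudeGroupBaseChange_le :
    (Q.lefschetzSimilitudeGroupBaseChange K).map (glExtendScalarsHom K L V) ≤ Q.lefschetzSimilitudeGroupBaseChange L := by
  rw [Subgroup.map_le_iff_le_comap, Q.comap_glExtendScalarsHom_lefschetzSimilitudeGroupBaseChange K L]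

end Points

end HodgeStructure

end Literature.AlgebraicGeometry.Motives

end
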